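/-
Copyright (c) 2026 the pub-hodgecm-mathlib formalisation cell (harness21).  Prover seat hodgecm-mathlib-K2Liu-p05 (g2), 2026-09-04
(Track B «K2-LIT», crux hLiu418 = stmt-HodgeConjecture-24832, socket #42F′ `sig_K2LiuFirstTermIdentityOnGenerators`, ROAD I v3 («uniqueness road»,
RULING M-156b), organ U2a «no rank 2 on the line», DEAL M-156c LEAD F0P6-plan (g12) 06:03:01Z).
-/
import Summits.HodgeConjecture.HodgeConjecture.Theorems.F0P2oLocallyConstantCoboundary   -- ★ p829212 Kudla's locally-constant partition trick (untwisted)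
import Literature.RepresentationTheory.TwistedCoinvariants                               -- ★ `TwistedCoinv.ker`, `Coinv`, `mk`, `ker_le_ker`
import Mathlib.Analysis.SpecialFunctions.Complex.Circle
import Mathlib.LinearAlgebra.Matrix.Determinant.Basic
import Mathlib.Data.Matrix.Mul
import HarnessLib

/-!
# U2a «NO RANK 2 ON THE LINE»: the `(N_w, ψ_β)`-twisted coinvariants of `𝒮(a′²_w)` VANISH for `det β ≠ 0` — the Gram matrix of a pair of vectors
# in a hermitian LINE has rank `≤ 1`

Track B ∕ K2-LIT, hLiu418 = stmt-HodgeConjecture-24832, socket #42F′ `sig_K2LiuFirstTermIdentityOnGenerators` (U6 ED. 10 :767), ROAD I v3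
(K2E5-plan (g5) `MAP-42F-ERRATUM-1-RoadI-v3` §1′ row U2a; RULING «M-156b»; DEAL «M-156c» → K2Liu-p05 (g2)).  Namespace
`Summit.HodgeConjecture.HodgeConjecture.Cruxes.HLiu418.K2LiuLineNoRankTwoCoinvariants`.  THEOREMS ONLY (no definition, no instance, no notation, no
named fact, no `sorry`); kernel lane `--supports stmt-HodgeConjecture-24832 --as helper`; count-neutral.

THE MATHEMATICS ([Kudla1986, proof of Thm. 2.8]; [MoeglinVignerasWaldspurger1987, Chap. 2 II.1, Chap. 3 §IV.5]; [Rallis1984, §4]; [BernsteinZelevinsky1976,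
§2.30–2.33]).  In a Schrödinger model `𝒮(𝕏_w)` of the local Weil representation of the dual pair `U(𝔻_w) × U(⟨a′⟩_w)` (`𝔻` the doubled 4-space,
`⟨a′⟩` a hermitian LINE) adapted to the Siegel parabolic of `U(𝔻)`, the unipotent radical `N_w ≅ Herm₂(L_w)` acts by the SECOND-DEGREE MULTIPLIERS
`(ω(n(b)) φ)(x) = ψ_v(⟪b, G(x)⟫) φ(x)` of the MOMENT MAP `G(x) = a′ · x x*` — the Gram matrix of the pair `x = (x₁, x₂)` of vectors of the line, of
rank `≤ 1` — while `ψ_β(n(b)) = ψ_v(⟪b, β⟫)`.  If `det β ≠ 0` then `G(x) ≠ β` for EVERY `x`, so every point of `𝕏_w` is moved by some multiplier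
`ψ_β(n)⁻¹ ω(n)`, and Kudla's locally-constant partition trick shows that every `φ ∈ 𝒮(𝕏_w)` is a finite sum of twisted coboundaries
`ω(n) φ′ − ψ_β(n) φ′`: **`𝒮(𝕏_w)_{N_w, ψ_β} = 0`**, hence (right-exactness) `R_{N_w, ψ_β} = 0` for every quotient `R` of `𝒮(𝕏_w)` (in particular for
the big theta lift `R₂(a′_w)`, (R3)'s easy half), and every `(N_w, ψ_β)`-equivariant («twisted Siegel–Whittaker») functional on `𝒮(𝕏_w)` vanishes.

WRITTEN ABSTRACT OVER THE MODEL (the local `R₂(a′_w)` ∕ `ψ_β` vocabulary of U2b ∕ U2 is not in the tree yet; LD2's brick (O2) precedent): the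
representation is ANY `ρ : Representation ℂ Z ↥(SchwartzBruhat X)` of ANY group `Z` on the Schwartz–Bruhat space of ANY topological space `X`
acting by locally constant multipliers; the two model inputs are the multiplier formula `hρ` and the character formula `hχ`.

* §1 THE TWISTED PARTITION TRICK (`mem_twistedCoinv_ker_of_forall_exists_ne`, `twistedCoinv_ker_eq_top_of_forall_exists_ne`, `twistedCoinv_mk_eq_zero_…`,
  `subsingleton_twistedCoinv_…`, `functional_eq_zero_…`): multipliers `u z`, character `χ`; if EVERY point is moved (`∀ x, ∃ z, u z x ≠ χ z`) then
  `TwistedCoinv.ker ρ χ = ⊤` — ★ p829212 `mem_span_mul_sub_of_forall_eq_zero` (χ = 1, exceptional set `∅`) applied to the multipliers `(χ z)⁻¹ · u z`.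
* §2 «THE MOMENT MAP MISSES `β`» (`exists_addChar_pairing_ne_one`, `twistedCoinv_ker_eq_top_of_momentMap_ne`): multipliers `ψ(π (b z) (G x))` for an
  additive character `ψ ≠ 1` of a field `F`, an `F`-bilinear pairing `π` on an `F`-module `B` non-degenerate in the second slot, a parametrisation
  `b : Z → B` onto `B`, a moment map `G : X → B`; character `χ z = ψ(π (b z) β)`; if `G x ≠ β` for all `x`, the `χ`-coinvariants vanish.
* §3 THE HEAD (`det_smul_vecMulVec_fin_two`, `smul_vecMulVec_ne_of_det_ne_zero`, **`lineNoRankTwoCoinvariants`**, `lineNoRankTwoFunctional_eq_zero`):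
  `B = Matrix (Fin 2) (Fin 2) R` over any commutative ring `R` (e.g. `L_w = L ⊗ L⁺_v`), `G x = a′ • vecMulVec (y x) (y′ x)` (the Gram matrix
  `(a′ yᵢ y′ⱼ)` of a pair in the line; `y′ = ȳ` in the application), `det β ≠ 0` ⇒ `TwistedCoinv.ker ρ χ = ⊤`, and every functional `Λ` with
  `Λ (ρ z φ) = χ z • Λ φ` is `0`.

HONEST LABEL: HC_CM is proved only modulo the 7 printed citations (2 remaining named inputs: hLiu418 = stmt-HodgeConjecture-24832, h413 =
stmt-HodgeConjecture-24833) until rung 0 closes; this file is one organ (U2a) of Road I for #42F′ and moves no counter.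

## References
* [Kudla1986] S. S. Kudla, *On the local theta-correspondence*, Invent. Math. 83 (1986) 229–255, proof of Thm. 2.8.
* [MoeglinVignerasWaldspurger1987] C. Mœglin, M.-F. Vignéras, J.-L. Waldspurger, LNM 1291 (1987), Chap. 2 II.1, Chap. 3 §IV.5.
* [Rallis1984] S. Rallis, *On the Howe duality conjecture*, Compositio Math. 51 (1984) 333–399, §4 (twisted Jacquet modules of the oscillator
  representation along the Siegel unipotent radical are supported on the represented `β`).
* [BernsteinZelevinsky1976] I. N. Bernstein, A. V. Zelevinsky, Russian Math. Surveys 31 (1976), §1.1, §2.30–2.33.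
-/

set_option autoImplicit false
set_option linter.dupNamespace false

noncomputable section

open Set
open Literature.NumberTheory.Automorphic Literature.RepresentationTheory
open Summit.HodgeConjecture.HodgeConjecture.Cruxes.H413.F0P2oLocallyConstantCoboundary

namespace Summit.HodgeConjecture.HodgeConjecture.Cruxes.HLiu418.K2LiuLineNoRankTwoCoinvariants

/-! ## §1 The twisted partition trick: multiplier representations moving every point have no `χ`-coinvariants -/

section Twisted

variable {X : Type*} [TopologicalSpace X] {Z : Type*} [Group Z]
  (ρ : Representation ℂ Z ↥(SchwartzBruhat X)) (u : Z → X → ℂ) (hu : ∀ z, IsLocallyConstant (u z))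
  (hρ : ∀ (z : Z) (φ : ↥(SchwartzBruhat X)), ((ρ z φ : ↥(SchwartzBruhat X)) : X → ℂ) = u z * φ)
  (χ : Z →* ℂˣ) (hsep : ∀ x : X, ∃ z : Z, u z x ≠ ((χ z : ℂˣ) : ℂ))

include hu hρ hsep in
/-- **THE TWISTED PARTITION TRICK.**  Let a group `Z` act on `𝒮(X)` by locally constant MULTIPLIERS `u z`, and let `χ` be a character such that every
point of `X` is MOVED: `∀ x, ∃ z, u z x ≠ χ z`.  Then every `φ ∈ 𝒮(X)` lies in the relation submodule `span {ρ z φ′ − χ z • φ′}` of the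
`χ`-coinvariants (Kudla's trick for the multipliers `(χ z)⁻¹ u z`, which move every point off the EMPTY exceptional set).
[cite: Kudla1986, proof of Thm. 2.8] [cite: BernsteinZelevinsky1976, §2.30–2.33] -/
theorem mem_twistedCoinv_ker_of_forall_exists_ne (φ : ↥(SchwartzBruhat X)) : φ ∈ TwistedCoinv.ker ρ χ := by
  -- Kudla's untwisted lemma for the multipliers `(χ z)⁻¹ · u z`, exceptional set `∅`
  have hmem := mem_span_mul_sub_of_forall_eq_zero (Set.range fun (z : Z) (x : X) => (((χ z)⁻¹ : ℂˣ) : ℂ) * u z x)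
    (by
      rintro _ ⟨z, rfl⟩
      exact (hu z).comp fun t => (((χ z)⁻¹ : ℂˣ) : ℂ) * t) (∅ : Set X)
    (fun x _ => by
      obtain ⟨z, hz⟩ := hsep x
      refine ⟨_, ⟨z, rfl⟩, fun h => hz ?_⟩
      have h' : (((χ z)⁻¹ : ℂˣ) : ℂ) * u z x = 1 := h
      rw [Units.val_inv_eq_inv_val, inv_mul_eq_one₀ (χ z).ne_zero] at h'
      exact h'.symm) φ.2 (fun x hx => absurd hx (Set.notMem_empty x))
  -- the ambient span lies in the image of the relation submodule
  have hle : Submodule.span ℂ {g : X → ℂ | ∃ u' ∈ Set.range (fun (z : Z) (x : X) => (((χ z)⁻¹ : ℂˣ) : ℂ) * u z x),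
      ∃ ψ ∈ SchwartzBruhat X, g = u' * ψ - ψ} ≤ (TwistedCoinv.ker ρ χ).map (SchwartzBruhat X).subtype := by
    refine Submodule.span_le.2 ?_
    rintro _ ⟨_, ⟨z, rfl⟩, ψ, hψ, rfl⟩
    refine ⟨(((χ z)⁻¹ : ℂˣ) : ℂ) • (ρ z ⟨ψ, hψ⟩ - ((χ z : ℂˣ) : ℂ) • ⟨ψ, hψ⟩),
      Submodule.smul_mem _ _ (TwistedCoinv.sub_mem_ker ρ χ z ⟨ψ, hψ⟩), ?_⟩
    rw [map_smul, map_sub, map_smul, Submodule.subtype_apply, Submodule.subtype_apply, hρ]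
    funext x
    simp only [Pi.smul_apply, Pi.sub_apply, Pi.mul_apply, smul_eq_mul]
    rw [mul_sub, ← mul_assoc, ← mul_assoc, Units.val_inv_eq_inv_val, inv_mul_cancel₀ (χ z).ne_zero, one_mul]
  obtain ⟨ψ, hψ, hψφ⟩ := hle hmem
  have : ψ = φ := Subtype.ext hψφ
  rw [← this]
  exact hψ

include hu hρ hsep in
/-- **… so the relation submodule is everything: `TwistedCoinv.ker ρ χ = ⊤`** («`𝒮(X)_{Z,χ} = 0`»).
[cite: Kudla1986, proof of Thm. 2.8] [cite: MoeglinVignerasWaldspurger1987, Chap. 3 §IV.5] -/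
theorem twistedCoinv_ker_eq_top_of_forall_exists_ne : TwistedCoinv.ker ρ χ = ⊤ :=
  Submodule.eq_top_iff'.2 (mem_twistedCoinv_ker_of_forall_exists_ne ρ u hu hρ χ hsep)

include hu hρ hsep in
/-- **… every vector dies in the `χ`-coinvariants.** [cite: Kudla1986, proof of Thm. 2.8] [cite: BernsteinZelevinsky1976, §2.30–2.33] -/
theorem twistedCoinv_mk_eq_zero_of_forall_exists_ne (φ : ↥(SchwartzBruhat X)) : TwistedCoinv.mk ρ χ φ = 0 := by
  rw [TwistedCoinv.mk_apply, Submodule.Quotient.mk_eq_zero]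
  exact mem_twistedCoinv_ker_of_forall_exists_ne ρ u hu hρ χ hsep φ

include hu hρ hsep in
/-- **… the `χ`-coinvariants are the zero module.** [cite: Kudla1986, proof of Thm. 2.8] [cite: MoeglinVignerasWaldspurger1987, Chap. 3 §IV.5] -/
theorem subsingleton_twistedCoinv_of_forall_exists_ne : Subsingleton (TwistedCoinv.Coinv ρ χ) := by
  refine ⟨fun p q => ?_⟩
  obtain ⟨φ, rfl⟩ := TwistedCoinv.mk_surjective ρ χ p
  obtain ⟨φ', rfl⟩ := TwistedCoinv.mk_surjective ρ χ q
  rw [twistedCoinv_mk_eq_zero_of_forall_exists_ne ρ u hu hρ χ hsep, twistedCoinv_mk_eq_zero_of_forall_exists_ne ρ u hu hρ χ hsep]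

include hu hρ hsep in
/-- **… and every `(Z, χ)`-EQUIVARIANT FUNCTIONAL (`Λ (ρ z φ) = χ z • Λ φ`) VANISHES** — the «twisted Whittaker functional» form.
[cite: MoeglinVignerasWaldspurger1987, Chap. 3 §IV.5] [cite: BernsteinZelevinsky1976, §2.30–2.33] -/
theorem functional_eq_zero_of_forall_exists_ne {M : Type*} [AddCommGroup M] [Module ℂ M] (Λ : ↥(SchwartzBruhat X) →ₗ[ℂ] M)
    (hΛ : ∀ (z : Z) (φ : ↥(SchwartzBruhat X)), Λ (ρ z φ) = ((χ z : ℂˣ) : ℂ) • Λ φ) : Λ = 0 := by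
  refine LinearMap.ext fun φ => ?_
  rw [LinearMap.zero_apply]
  exact TwistedCoinv.ker_le_ker ρ χ Λ hΛ (mem_twistedCoinv_ker_of_forall_exists_ne ρ u hu hρ χ hsep φ)

end Twisted

/-! ## §2 «The moment map misses `β`»: second-degree multipliers `ψ(⟪b, G x⟫)` against the character `ψ(⟪b, β⟫)` -/

section MomentMap

variable {F : Type*} [Field F] {B : Type*} [AddCommGroup B] [Module F B]
  (π : B →ₗ[F] B →ₗ[F] F) (hπ : ∀ H : B, H ≠ 0 → ∃ b : B, π b H ≠ 0)
  (ψ : AddChar F Circle) (hψ : ∃ a : F, ((ψ a : Circle) : ℂ) ≠ 1)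

include hπ hψ in
/-- **a non-zero `H` is detected by the characters `b ↦ ψ(⟪b, H⟫)`**: `ψ ≠ 1` and `⟪·, H⟫ ≠ 0` is onto `F`.
[cite: MoeglinVignerasWaldspurger1987, Chap. 2 II.1] -/
theorem exists_addChar_pairing_ne_one {H : B} (hH : H ≠ 0) : ∃ b : B, ((ψ (π b H) : Circle) : ℂ) ≠ 1 := by
  obtain ⟨b₀, hb₀⟩ := hπ H hH
  obtain ⟨a, ha⟩ := hψ
  refine ⟨(a / π b₀ H) • b₀, ?_⟩
  rwa [map_smul, LinearMap.smul_apply, smul_eq_mul, div_mul_cancel₀ a hb₀]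

include hπ hψ in
/-- **if `G x ≠ β`, some multiplier `ψ(⟪b, G x⟫)` differs from the character value `ψ(⟪b, β⟫)`.** [cite: MoeglinVignerasWaldspurger1987, Chap. 2 II.1] -/
theorem exists_addChar_pairing_ne {Gx β : B} (h : Gx ≠ β) :
    ∃ b : B, ((ψ (π b Gx) : Circle) : ℂ) ≠ ((ψ (π b β) : Circle) : ℂ) := by
  obtain ⟨b, hb⟩ := exists_addChar_pairing_ne_one π hπ ψ hψ (sub_ne_zero.2 h)
  refine ⟨b, fun heq => hb ?_⟩
  have hmul : ((ψ (π b Gx) : Circle) : ℂ) = ((ψ (π b (Gx - β)) : Circle) : ℂ) * ((ψ (π b β) : Circle) : ℂ) := by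
    rw [← Circle.coe_mul, ← AddChar.map_add_eq_mul, map_sub, sub_add_cancel]
  rw [heq] at hmul
  exact (mul_eq_right₀ (Circle.coe_ne_zero _)).1 hmul.symm

include hπ hψ in
/-- **THE MOMENT MAP MISSES `β` ⇒ NO `ψ_β`-COINVARIANTS.**  Let `Z` act on `𝒮(X)` by the second-degree multipliers `x ↦ ψ(⟪b z, G x⟫)` of a moment map
`G : X → B` (`b : Z → B` onto), and let `χ z = ψ(⟪b z, β⟫)`.  If `G x ≠ β` for every `x`, then `TwistedCoinv.ker ρ χ = ⊤`.
[cite: Kudla1986, proof of Thm. 2.8] [cite: Rallis1984, §4] [cite: MoeglinVignerasWaldspurger1987, Chap. 3 §IV.5] -/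
theorem twistedCoinv_ker_eq_top_of_momentMap_ne {X : Type*} [TopologicalSpace X] {Z : Type*} [Group Z]
    (ρ : Representation ℂ Z ↥(SchwartzBruhat X)) (b : Z → B) (hb : Function.Surjective b) (G : X → B) (β : B) (hβ : ∀ x, G x ≠ β)
    (hu : ∀ z, IsLocallyConstant fun x => ((ψ (π (b z) (G x)) : Circle) : ℂ))
    (hρ : ∀ (z : Z) (φ : ↥(SchwartzBruhat X)),
      ((ρ z φ : ↥(SchwartzBruhat X)) : X → ℂ) = (fun x => ((ψ (π (b z) (G x)) : Circle) : ℂ)) * φ)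
    (χ : Z →* ℂˣ) (hχ : ∀ z, ((χ z : ℂˣ) : ℂ) = ((ψ (π (b z) β) : Circle) : ℂ)) :
    TwistedCoinv.ker ρ χ = ⊤ := by
  refine twistedCoinv_ker_eq_top_of_forall_exists_ne ρ (fun z x => ((ψ (π (b z) (G x)) : Circle) : ℂ)) hu hρ χ fun x => ?_
  obtain ⟨b₁, hb₁⟩ := exists_addChar_pairing_ne π hπ ψ hψ (hβ x)
  obtain ⟨z, rfl⟩ := hb b₁
  exact ⟨z, by rw [hχ]; exact hb₁⟩

end MomentMap

/-! ## §3 The head: the Gram matrix of a pair of vectors in a line has rank `≤ 1` -/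

section Line

/-- **`det (a′ · y ⊗ y′) = 0`**: the Gram matrix `(a′ yᵢ y′ⱼ)` of a PAIR of vectors in a hermitian LINE has rank `≤ 1`. [cite: Rallis1984, §4] -/
theorem det_smul_vecMulVec_fin_two {R : Type*} [CommRing R] (a : R) (y y' : Fin 2 → R) : (a • Matrix.vecMulVec y y').det = 0 := by
  rw [Matrix.det_fin_two]
  simp only [Matrix.smul_apply, Matrix.vecMulVec_apply, smul_eq_mul]
  ring

/-- **… so a non-degenerate `β` (`det β ≠ 0`) is never such a Gram matrix.** [cite: Rallis1984, §4] -/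
theorem smul_vecMulVec_ne_of_det_ne_zero {R : Type*} [CommRing R] (a : R) (y y' : Fin 2 → R) {β : Matrix (Fin 2) (Fin 2) R}
    (hβ : β.det ≠ 0) : a • Matrix.vecMulVec y y' ≠ β := fun h =>
  hβ (by rw [← h]; exact det_smul_vecMulVec_fin_two a y y')

variable {F : Type*} [Field F] {R : Type*} [CommRing R] [Module F R]
  (π : Matrix (Fin 2) (Fin 2) R →ₗ[F] Matrix (Fin 2) (Fin 2) R →ₗ[F] F)
  (hπ : ∀ H : Matrix (Fin 2) (Fin 2) R, H ≠ 0 → ∃ b, π b H ≠ 0)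
  (ψ : AddChar F Circle) (hψ : ∃ a : F, ((ψ a : Circle) : ℂ) ≠ 1)
  {X : Type*} [TopologicalSpace X] {Z : Type*} [Group Z] (ρ : Representation ℂ Z ↥(SchwartzBruhat X))
  (b : Z → Matrix (Fin 2) (Fin 2) R) (hb : Function.Surjective b)
  (a' : R) (y y' : X → Fin 2 → R) (β : Matrix (Fin 2) (Fin 2) R) (hβ : β.det ≠ 0)
  (hu : ∀ z, IsLocallyConstant fun x => ((ψ (π (b z) (a' • Matrix.vecMulVec (y x) (y' x))) : Circle) : ℂ))
  (hρ : ∀ (z : Z) (φ : ↥(SchwartzBruhat X)),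
    ((ρ z φ : ↥(SchwartzBruhat X)) : X → ℂ) = (fun x => ((ψ (π (b z) (a' • Matrix.vecMulVec (y x) (y' x))) : Circle) : ℂ)) * φ)
  (χ : Z →* ℂˣ) (hχ : ∀ z, ((χ z : ℂˣ) : ℂ) = ((ψ (π (b z) β) : Circle) : ℂ))

include hπ hψ hb hβ hu hρ hχ in
/-- **U2a «NO RANK 2 ON THE LINE».**  In any Schrödinger-type model `𝒮(X)` in which the Siegel unipotent radical (`Z`, read through `b : Z → M₂(R)` onto the
hermitian parameters) acts by the second-degree multipliers `x ↦ ψ(⟪b z, a′ · y(x) ⊗ y′(x)⟫)` of the GRAM MATRIX of a pair of vectors in the line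
`⟨a′⟩`, the `ψ_β`-twisted coinvariants (`ψ_β z = ψ(⟪b z, β⟫)`) VANISH as soon as `det β ≠ 0`: **`TwistedCoinv.ker ρ ψ_β = ⊤`**, i.e.
`𝒮(a′²_w)_{N_w, ψ_β} = 0`. [cite: Kudla1986, proof of Thm. 2.8] [cite: Rallis1984, §4] [cite: MoeglinVignerasWaldspurger1987, Chap. 3 §IV.5] -/
theorem lineNoRankTwoCoinvariants : TwistedCoinv.ker ρ χ = ⊤ :=
  twistedCoinv_ker_eq_top_of_momentMap_ne π hπ ψ hψ ρ b hb (fun x => a' • Matrix.vecMulVec (y x) (y' x)) β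
    (fun x => smul_vecMulVec_ne_of_det_ne_zero a' (y x) (y' x) hβ) hu hρ χ hχ

include hπ hψ hb hβ hu hρ hχ in
/-- **… hence the `(N_w, ψ_β)`-twisted «Siegel–Whittaker» functional of the line VANISHES for `det β ≠ 0`**: every linear `Λ` on `𝒮(X)` with
`Λ (ρ z φ) = ψ_β z • Λ φ` is `0`. [cite: Rallis1984, §4] [cite: MoeglinVignerasWaldspurger1987, Chap. 3 §IV.5] -/
theorem lineNoRankTwoFunctional_eq_zero {M : Type*} [AddCommGroup M] [Module ℂ M] (Λ : ↥(SchwartzBruhat X) →ₗ[ℂ] M)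
    (hΛ : ∀ (z : Z) (φ : ↥(SchwartzBruhat X)), Λ (ρ z φ) = ((χ z : ℂˣ) : ℂ) • Λ φ) : Λ = 0 := by
  refine LinearMap.ext fun φ => ?_
  rw [LinearMap.zero_apply]
  refine TwistedCoinv.ker_le_ker ρ χ Λ hΛ ?_
  rw [lineNoRankTwoCoinvariants π hπ ψ hψ ρ b hb a' y y' β hβ hu hρ χ hχ]
  exact Submodule.mem_top

include hπ hψ hb hβ hu hρ hχ in
/-- **… and the `ψ_β`-coinvariant module is `0`.** [cite: Kudla1986, proof of Thm. 2.8] [cite: Rallis1984, §4] -/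
theorem subsingleton_lineCoinvariants : Subsingleton (TwistedCoinv.Coinv ρ χ) :=
  subsingleton_twistedCoinv_of_forall_exists_ne ρ (fun z x => ((ψ (π (b z) (a' • Matrix.vecMulVec (y x) (y' x))) : Circle) : ℂ)) hu hρ χ
    fun x => by
      obtain ⟨b₁, hb₁⟩ := exists_addChar_pairing_ne π hπ ψ hψ (smul_vecMulVec_ne_of_det_ne_zero a' (y x) (y' x) hβ)
      obtain ⟨z, rfl⟩ := hb b₁
      exact ⟨z, by rw [hχ]; exact hb₁⟩

end Line

end Summit.HodgeConjecture.HodgeConjecture.Cruxes.HLiu418.K2LiuLineNoRankTwoCoinvariants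

end
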